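import Mathlib
import Summits.NavierStokesRegularity.NavierStokesRegularity.Theorems.EulerZoomLiouvillePowerGaugeEulerLiouvilleStretchingBudgetStarvation
import Summits.NavierStokesRegularity.NavierStokesRegularity.Theorems.EulerZoomLiouvillePowerGaugeEulerLiouvilleStretchingBudgetFloorTransport
import Summits.NavierStokesRegularity.NavierStokesRegularity.Theorems.EulerZoomLiouvillePowerGaugeEulerLiouvillePastIrrotational
import HarnessLib

/-!
# Crux `EulerZoomLiouville.PowerGaugeEulerLiouville` (stmt-NavierStokesRegularity-19832), line `stretching-budget`:
# THE STRATUM THEOREM — a classical member with a drifting far past and a sub-threshold stretching budget is trivial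

Route №10 `EulerZoomLiouville` (NavierStokesRegularity), crux E.  Line `stretching-budget` (ideator ns-idea-11 g4;
`Cruxes/PowerGaugeEulerLiouville/Lines/stretching_budget.lean`; idea-crit V33 PASS-WITH-PRICE).  The line's composition
`PowerGaugeEulerLiouville_of : K1 → K2 → K3 → crux` minus the OPEN residue K3, at MEMBER level, for the LEAD's skeleton `birth`:
with K1 (`StretchingBudget.floorBlobsPersist_of_driftingPast`, p630159) and K2 (`StretchingBudget.pastCurlFree_of_floorBlobsPersist`,
p629500) landed, a member of the power-gauged class (`0 < ρ ≤ 1/2`) in the stratum `IsStretchingBudgeted ρ u p` (a drifting classical far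
past `(T₁, M, κ)` with a stretching budget `(K, Λ)`, `0 ≤ K < K₀(ρ,κ) = min((1+ρ)/4, (κ+ρ−κρ)/2)`) has an irrotational far past `(−∞,T₁)`,
hence vanishes a.e. on the past slab by the LEAD's landed filler `PastIrrotational.ae_eq_zero_of_gauge_of_pastIrrotational`.

* **`ae_eq_zero_of_gauge_of_stretchingBudgeted`** — crux hypotheses verbatim + the stratum hypothesis `IsStretchingBudgeted ρ u p`
  `δ`-unfolded (glue `example : ∀ ρ …, InClass ρ u p H c → IsStretchingBudgeted ρ u p → VanishesAE u` checked rc 0 against the Cruxes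
  definitions pasted verbatim).

HONEST LABEL (the card's): a STRATUM theorem — general 3D, no symmetry, no self-similarity, no Type-I rate, no gradient decay; the price is
`K₀ ≤ 3/8`; every putative self-similar member has stretching rate `≥ 1/(−τ)` along vortical paths and sits OUTSIDE the stratum.
WHAT THIS IS NOT: not NS, not the crux — `--supports` stmt-19832; the residue K3 `stub_budgetRest` (members outside the stratum) is OPEN and
not claimed; crux 19832, rung N0 and NS regularity stay OPEN; no summit statement is proved here.  [folklore]
-/

noncomputable section

-- flat `Theorems/<Route><Decl>…` files of one crux share the namespace of the crux (tree convention)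
set_option linter.dupNamespace false

open MeasureTheory Set Filter Topology Metric Function
open scoped NNReal ENNReal RealInnerProductSpace

namespace Summit.NavierStokesRegularity.NavierStokesRegularity.Theorems.PowerGaugeEulerLiouville.StretchingBudget

open Literature.Analysis Literature.Analysis.FluidPDE

/-- **The `stretching-budget` stratum of crux E is trivial** (member level; crux hypotheses verbatim, stratum hypothesis
`IsStretchingBudgeted ρ u p` unfolded): for `0 < ρ ≤ 1/2`, a member `(u,p,H,c)` of Seregin's power-gauged ancient Euler class that is
classical on `(−∞,0)` with a drifting far past `(T₁, M, κ)` (velocity envelope `M(−τ)^{−κ}`, `κ < 1`; gradient bounded on compact time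
intervals) and a stretching budget `(K, Λ)` with `0 ≤ K < min((1+ρ)/4, (κ+ρ−κρ)/2)` vanishes a.e. on the past slab.  Proof: K1
(floor transport) feeds K2 (budget starvation), which makes `(−∞,T₁)` irrotational; the landed irrotational-past filler concludes.
[cite: MajdaBertozziCUP2002, §1.6 (1.50)–(1.51); Chae2010, Thm 1.1 (proof display)] -/
theorem ae_eq_zero_of_gauge_of_stretchingBudgeted {ρ : ℝ} (hρ : 0 < ρ) (hρ2 : ρ ≤ 1 / 2)
    {u : ℝ → EuclideanSpace ℝ (Fin 3) → EuclideanSpace ℝ (Fin 3)} {p : ℝ → EuclideanSpace ℝ (Fin 3) → ℝ}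
    {H : ℝ → EuclideanSpace ℝ (Fin 3) → EuclideanSpace ℝ (Fin 3) →L[ℝ] EuclideanSpace ℝ (Fin 3)} {c : ℝ≥0}
    (hsw : IsSuitableWeakSolutionOn (slab (EuclideanSpace ℝ (Fin 3)) (Set.Iio 0) isOpen_Iio) 0 0 u p)
    (hH : HasWeakSpatialGradientOn (slab (EuclideanSpace ℝ (Fin 3)) (Set.Iio 0) isOpen_Iio) u H)
    (hc : ∀ a : ℝ, 0 < a →
      ENNReal.ofReal (a ^ (2 * ρ)) * cknA a (0 : ℝ × EuclideanSpace ℝ (Fin 3)) u +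
          ENNReal.ofReal (a ^ ρ) * cknE a (0 : ℝ × EuclideanSpace ℝ (Fin 3)) H +
        ENNReal.ofReal (a ^ (2 * ρ)) * cknD a (0 : ℝ × EuclideanSpace ℝ (Fin 3)) p ≤ (c : ℝ≥0∞))
    (hstratum : ∃ T₁ M κ K : ℝ, ∃ Λ : ℝ → ℝ,
      (IsClassicalEulerSolutionOn (Set.Iio 0) 0 u p ∧ T₁ ≤ 0 ∧ 0 ≤ M ∧ κ < 1 ∧
          (∀ τ : ℝ, τ < T₁ → ∀ x : EuclideanSpace ℝ (Fin 3), ‖u τ x‖ ≤ M * (-τ) ^ (-κ)) ∧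
          (∀ t₁ t₂ : ℝ, t₁ < t₂ → t₂ < 0 → ∃ L : ℝ, ∀ τ ∈ Set.Icc t₁ t₂, ∀ x : EuclideanSpace ℝ (Fin 3),
            ‖fderiv ℝ (u τ) x‖ ≤ L)) ∧
        0 ≤ K ∧ K < min ((1 + ρ) / 4) ((κ + ρ - κ * ρ) / 2) ∧
        (IntegrableOn Λ (Set.Iio T₁) ∧ (∀ τ : ℝ, 0 ≤ Λ τ) ∧
          ∀ τ : ℝ, τ < T₁ → ∀ x : EuclideanSpace ℝ (Fin 3),
            ⟪fderiv ℝ (u τ) x (curl (u τ) x), curl (u τ) x⟫ ≤ (K / (-τ) + Λ τ) * ‖curl (u τ) x‖ ^ 2)) :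
    Function.uncurry u =ᵐ[volume.restrict (Set.Iio (0 : ℝ) ×ˢ (Set.univ : Set (EuclideanSpace ℝ (Fin 3))))] 0 := by
  obtain ⟨T₁, M, κ, K, Λ, hD, hK0, hK, hB⟩ := hstratum
  have hcurl : ∀ τ : ℝ, τ < T₁ → ∀ x : EuclideanSpace ℝ (Fin 3), curl (u τ) x = 0 :=
    pastCurlFree_of_floorBlobsPersist ρ hρ hρ2 u p H c ⟨hsw, hH, hc⟩ T₁ M κ K Λ hD hK0 hK hB
      (floorBlobsPersist_of_driftingPast u p T₁ M κ K Λ hD hK0 hB)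
  have hcl : IsClassicalEulerSolutionOn (Set.Iio 0) 0 u p := hD.1
  have hT₁ : T₁ ≤ 0 := hD.2.1
  have hmem : ∀ τ : ℝ, τ < T₁ → τ ∈ Set.Iio (0 : ℝ) := fun τ hτ => lt_of_lt_of_le hτ hT₁
  exact PastIrrotational.ae_eq_zero_of_gauge_of_pastIrrotational hρ hρ2 hsw hH hc hT₁
    (fun τ hτ => (hcl.contDiff_velocity (hmem τ hτ)).of_le (by norm_cast))
    (fun τ hτ => hcl.divFree τ (hmem τ hτ)) hcurl

end Summit.NavierStokesRegularity.NavierStokesRegularity.Theorems.PowerGaugeEulerLiouville.StretchingBudget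

end
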